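import Summits.ValiantsHypothesis.ValiantsHypothesis.Theses.RigidityForcesSymmetry
import Summits.ValiantsHypothesis.ValiantsHypothesis.Theorems.BorderApolarityToricWitnessObstructionQPStubTorusBound

/-!
# F3 / BC5 witness for the rung `PairTiedTorusBound` (seed g1-ValiantsHypothesis-4164)

The rung family `TiedTorusBound k` specialises at `k = 0` to the PROVED floor
`RigidityForcesSymmetry.TorusBound` (tree theorem
`Summit.ValiantsHypothesis.ValiantsHypothesis.Theorems.BorderApolarityToricWitnessObstructionQP.stub_torusBound`).

CANONICAL WITNESS: `theorem floor_rung : TiedTorusBound 0` inside the registered skeleton module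
`Summits.ValiantsHypothesis.ValiantsHypothesis.Cruxes.RankRigidMinimalRepr.Lines.PairTiedTorusBound`
(sorry-free in its cone; that file checks rc 0 with sorries only in `stub_levelDecomp`, `stub_levelBound`).
This self-contained copy exists because the farm had not yet built that module when the seat filed
(`remote:stale:unbuilt`), so `import …Lines.PairTiedTorusBound` could not be elaborated; the five definitions
below are VERBATIM copies (namespace `….PairTiedTorusBound.Special`) and the `example` is the F3 shape
`example : Rung-family <floor parameter> := by simpa [defs] using <floor decl>`.
The import-based twin is `bc/PairTiedTorusBound_special.lean` in the seat folder (attached as evidence).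
-/

open Literature.Computability.AlgebraicComplexity

set_option linter.dupNamespace false

namespace Summit.ValiantsHypothesis.ValiantsHypothesis.Cruxes.RankRigidMinimalRepr.PairTiedTorusBound.Special

/-- verbatim copy of `…PairTiedTorusBound.tiedTorusGen` -/
def tiedTorusGen (m k : ℕ) : Set (GL (Fin m × Fin m) ℂ) :=
  {γ | ∃ d e : Fin m → ℂ, (∀ j j' : Fin m, j.val ≤ k → j'.val ≤ k → e j = e j') ∧
    (γ : Matrix (Fin m × Fin m) (Fin m × Fin m) ℂ) = Matrix.diagonal (fun p => d p.1 * e p.2)}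
/-- verbatim copy -/
def tiedTorus (m k : ℕ) : Subgroup (GL (Fin m × Fin m) ℂ) := Subgroup.closure (tiedTorusGen m k)
/-- verbatim copy -/
def EquivariantGrenetBound (H : ∀ m : ℕ, Subgroup (GL (Fin m × Fin m) ℂ)) : Prop :=
  ∀ m : ℕ, 3 ≤ m → ∀ (n : ℕ) (A : Matrix (Fin n) (Fin n) (MvPolynomial (Fin m × Fin m) ℂ)),
    IsEquivariantDetRepr (H m) (perPoly (Fin m) ℂ) A → 2 ^ m - 1 ≤ n
/-- verbatim copy -/
def TiedTorusBound (k : ℕ) : Prop := EquivariantGrenetBound (fun m => tiedTorus m k)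
/-- verbatim copy: THE RUNG -/
def PairTiedTorusBound : Prop := TiedTorusBound 1

/-- With no tie the generating set is literally the floor's. -/
theorem tiedTorusGen_zero (m : ℕ) :
    tiedTorusGen m 0 = {γ : GL (Fin m × Fin m) ℂ | ∃ d e : Fin m → ℂ,
      (γ : Matrix (Fin m × Fin m) (Fin m × Fin m) ℂ) = Matrix.diagonal (fun p => d p.1 * e p.2)} := by
  ext γ
  constructor
  · rintro ⟨d, e, -, hγ⟩
    exact ⟨d, e, hγ⟩
  · rintro ⟨d, e, hγ⟩
    refine ⟨d, e, fun j j' hj hj' => ?_, hγ⟩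
    have : j = j' := Fin.ext (by omega)
    rw [this]

/-- **F3 witness**: the floor member of the rung family, from the floor theorem. -/
example : TiedTorusBound 0 := by
  simpa [TiedTorusBound, EquivariantGrenetBound, tiedTorus, tiedTorusGen_zero,
    Summit.ValiantsHypothesis.ValiantsHypothesis.Theses.RigidityForcesSymmetry.TorusBound] using
    Summit.ValiantsHypothesis.ValiantsHypothesis.Theorems.BorderApolarityToricWitnessObstructionQP.stub_torusBound

/-- Named form. -/
theorem tiedTorusBound_zero : TiedTorusBound 0 := by
  simpa [TiedTorusBound, EquivariantGrenetBound, tiedTorus, tiedTorusGen_zero,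
    Summit.ValiantsHypothesis.ValiantsHypothesis.Theses.RigidityForcesSymmetry.TorusBound] using
    Summit.ValiantsHypothesis.ValiantsHypothesis.Theorems.BorderApolarityToricWitnessObstructionQP.stub_torusBound

/-- The rung implies the floor (the family is graded; `k = 0 ≤ 1`). -/
theorem torusBound_of_pairTied (h : PairTiedTorusBound) :
    Summit.ValiantsHypothesis.ValiantsHypothesis.Theses.RigidityForcesSymmetry.TorusBound := by
  have h0 : TiedTorusBound 0 := fun m hm n A hA =>
    h m hm n A (hA.anti (Subgroup.closure_mono (by
      rintro γ ⟨d, e, he, hγ⟩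
      exact ⟨d, e, fun j j' hj hj' => he j j' (by omega) (by omega), hγ⟩)))
  simpa [TiedTorusBound, EquivariantGrenetBound, tiedTorus, tiedTorusGen_zero,
    Summit.ValiantsHypothesis.ValiantsHypothesis.Theses.RigidityForcesSymmetry.TorusBound] using h0

#print axioms tiedTorusBound_zero

end Summit.ValiantsHypothesis.ValiantsHypothesis.Cruxes.RankRigidMinimalRepr.PairTiedTorusBound.Special
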